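import Literature.NumberTheory.Automorphic.HyperspecialUnitaryCartanUnique
import Literature.NumberTheory.Automorphic.HeckePairsValuedFiniteResidueField
import Literature.NumberTheory.Automorphic.UnitaryTwoUnipotentClasses
import Literature.NumberTheory.Automorphic.GLnCongruenceSubgroups
import Literature.LinearAlgebra.Matrix.FiniteFieldHermitianAnisotropic

/-!
# R90 · S6 (Rogawski Ch. 14.1–5, stable trace formula) — W8-e: the index of a `K₀`-double coset SEPARATES the double cosets of
# the quasi-split `U(1,1) = U(σ, J₀)(K)`, `J₀ = antidiag(1,1)`, `K₀ = U(σ, J₀) ∩ GL₂(𝒪)` (the `hsep` PAYER at `N = 2`)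

Helper for the S6 floor (E1-c) `R90.S6.StubR90ExtE1HeckeFL` ∕ (E1-d) `R90.S6.StubR90ExtE1TwistedTransferFL` (`Cruxes/H413/Lines/R90_S6_FloorE1D.lean`):
the hypothesis `hsep` of ★ `R90.S6.mk_mulEquiv_mem_orbit_of_ncard_separates` ∕ ★ `R90.S6.coeff_toVector_comp_eq_of_memLaw` (W7-a.3∕a.4, the `eG`∕`eH`-
independence of the socket's Hecke functions) at the `U(Φ₂)`-factor of `H_v`; target W8-e of the S6 WAVE 8 sheet
(`R90/R90-C14-typ2/g2/S6_wave8_targets.v1.b05122f413d1b42e.lean` :117, statement VERBATIM, namespace without `.Wave8`), DAG r5 row E1.3.9.1.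

THE MATHEMATICS.  By the Cartan decomposition [BruhatTits1972, (4.4.3)] (★ `heckeCosetMk_zpowDiagGL_eq_of_unitary`) every double coset of
`U = U(σ, J₀)(K)` modulo `K₀` is `K₀ t_n K₀`, `t_n = diag(ϖⁿ, ϖ⁻ⁿ)`, `n ≥ 0`.  Its INDEX `#(K₀ t_n K₀ ∕ K₀)` is the `K₀`-orbit size of `t_n K₀` in
`U ∕ K₀`, i.e. `[K₀ : S_n]` with `S_n = K₀ ∩ t_n K₀ t_n⁻¹` (orbit–stabiliser).  We do NOT compute it (it is `(q+1)q^{2n−1}` for `n ≥ 1` — the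
`(q+1)`-regular tree of `SU(1,1) ≅ SL₂`); instead: `S_n = {k ∈ K₀ : ϖ^{−2n} k₀₁ ∈ 𝒪, ϖ^{−2n} (k⁻¹)₀₁ ∈ 𝒪}` (conjugating by `t_n` multiplies the
`(0,1)` entry by `ϖ^{−2n}` and the `(1,0)` entry by `ϖ^{2n}`), so `S_{n′} ≤ S_n` for `n ≤ n′`, and STRICTLY: the residual binders force `σ̄ = Frob_q ≠ id`
(★ `exists_frob_ne`), whence a unit `δ` with `σδ = −δ`, and the unipotent `n(ϖ^{2n}δ) = (1 ϖ^{2n}δ; 0 1) ∈ U` (★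
`mem_unitaryGroupOfForm_iff_of_coe_eq_lineUnipotent`: `σx + x = 0`) lies in `S_n ∖ S_{n′}`.  The orbits are finite (★ `finite_orbit_quotient_unitaryInt`),
so `n ↦ [K₀ : S_n]` is STRICTLY INCREASING (Mathlib `Subgroup.index_strictAnti`), hence injective: equal indices force equal shells, i.e. the
same double coset.  (For `σ = id` — not excluded by `UnramifiedLocalConjDatum` alone — `U` is the split orthogonal group, every shell `n ≥ 1` has
index `2` and the statement fails: the binders `hσO σk hσk hk hfrob` are load-bearing exactly through `σ ≠ id`.)

Cell `hodgecm-mathlib`, crux H413 (`stmt-HodgeConjecture-24833`), route of record `HCCMUnconditional`; programme R90-TF (brief `director/R90-BRIEF.v2.md`),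
section S6 (base `R90-C14`), seat R90-C14-p02 (g2), card W8-e (S6 dealer R90-C14-plan (g2) 2026-09-04T23:34:54Z; sheet box AUDIT S6#W8 CLEAN
23:37:31Z).  Lane `--supports stmt-HodgeConjecture-24833 --as helper`; ONE public theorem (+ private lemmas), no definition, no `sorry`, no instance,
no notation.  HONEST LABEL: a helper theorem, count-neutral until the E1.3.9 assembly consumes `hsep`; HC_CM is proved only modulo the 7 printed
citations (2 remaining named inputs: hLiu418 = stmt-HodgeConjecture-24832, h413 = stmt-HodgeConjecture-24833) until rung 0 closes.

## References
* [BruhatTits1972] F. Bruhat, J. Tits, *Groupes réductifs sur un corps local I*, Publ. Math. IHÉS 41 (1972), (4.4.3), (4.4.4).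
* [Serre1980Trees] J.-P. Serre, *Trees* (1980), II.1.1 (the tree of `SL₂` over a local field; shells = spheres).
* [Rogawski1990] J. D. Rogawski, *Automorphic Representations of Unitary Groups in Three Variables*, Ann. of Math. Stud. 123 (1990), §1.10 p. 9
  (`n(t)`, the torus of `U(Φ₂)`), §4.9 p. 55.
-/

set_option autoImplicit false
-- the mandated namespace repeats the single-problem summit's segment (`HodgeConjecture.HodgeConjecture`)
set_option linter.dupNamespace false

noncomputable section

open scoped Valued WithZero Matrix MatrixGroups

open Literature.NumberTheory.Automorphic Literature.NumberTheory.Automorphic.HermitianLattice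
  Literature.NumberTheory.Automorphic.CartanUnique Literature.NumberTheory.Automorphic.UnitaryGroup

namespace Summit.HodgeConjecture.HodgeConjecture.R90.S6

section

variable {K : Type*} [Field K] [Valued K ℤᵐ⁰] {σ : K →+* K} {ϖ : K}

/-! ## §1 The Cartan exponents at `N = 2`: `a = (n, −n)`, `n ≥ 0` -/

/-- On `Fin 2`, an antitone `a` with `a ∘ rev = −a` is `(n, −n)` with `n = a 0 ≥ 0`. [cite: BruhatTits1972, (4.4.3)] -/
private theorem cartan_two_shape {a : Fin 2 → ℤ} (ha : Antitone a ∧ ∀ i, a (Fin.rev i) = -a i) : a 1 = -a 0 ∧ 0 ≤ a 0 := by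
  have h1 : a 1 = -a 0 := by
    have h := ha.2 0
    rwa [show Fin.rev (0 : Fin 2) = 1 from rfl] at h
  have h2 : a 1 ≤ a 0 := ha.1 (show (0 : Fin 2) ≤ 1 by decide)
  exact ⟨h1, by omega⟩

/-- Two `N = 2` Cartan exponents with the same first coordinate are equal. [cite: BruhatTits1972, (4.4.3)] -/
private theorem cartan_two_ext {a a' : Fin 2 → ℤ} (ha : Antitone a ∧ ∀ i, a (Fin.rev i) = -a i)
    (ha' : Antitone a' ∧ ∀ i, a' (Fin.rev i) = -a' i) (h : a 0 = a' 0) : a = a' := by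
  have h1 := (cartan_two_shape ha).1
  have h1' := (cartan_two_shape ha').1
  funext i
  refine Fin.cases ?_ (fun j => ?_) i
  · exact h
  · have hj : j = 0 := Subsingleton.elim _ _
    subst hj
    change a 1 = a' 1
    rw [h1, h1', h]

/-- `v(ϖ^e) ≤ 1` for `e ≥ 0`. [folklore] -/
private theorem v_zpow_le_one (hϖ : Valued.v ϖ = WithZero.exp (-1 : ℤ)) {e : ℤ} (he : 0 ≤ e) : Valued.v (ϖ ^ e) ≤ 1 := by
  rw [v_uniformizer_zpow hϖ, ← WithZero.exp_zero, WithZero.exp_le_exp]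
  omega

/-! ## §2 The stabiliser of the shell representative `t_a K₀` in `K₀` -/

/-- **Orbit–stabiliser bookkeeping**: `k ∈ K₀` fixes the coset `t K₀` iff `t⁻¹ k t ∈ K₀`. [folklore] -/
private theorem mem_stabilizer_coe_iff (t : ↥(unitaryGroupOfForm σ ((StdForm.antidiagonal 2).over K)))
    (k : ↥(unitaryInt σ ((StdForm.antidiagonal 2).over K))) :
    k ∈ MulAction.stabilizer (↥(unitaryInt σ ((StdForm.antidiagonal 2).over K)))
        (t : ↥(unitaryGroupOfForm σ ((StdForm.antidiagonal 2).over K)) ⧸ unitaryInt σ ((StdForm.antidiagonal 2).over K)) ↔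
      t⁻¹ * (k : ↥(unitaryGroupOfForm σ ((StdForm.antidiagonal 2).over K))) * t ∈ unitaryInt σ ((StdForm.antidiagonal 2).over K) := by
  rw [MulAction.mem_stabilizer_iff]
  change (((k : ↥(unitaryGroupOfForm σ ((StdForm.antidiagonal 2).over K))) * t :
        ↥(unitaryGroupOfForm σ ((StdForm.antidiagonal 2).over K))) :
      ↥(unitaryGroupOfForm σ ((StdForm.antidiagonal 2).over K)) ⧸ unitaryInt σ ((StdForm.antidiagonal 2).over K)) =
      (t : ↥(unitaryGroupOfForm σ ((StdForm.antidiagonal 2).over K)) ⧸ unitaryInt σ ((StdForm.antidiagonal 2).over K)) ↔ _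
  rw [QuotientGroup.eq, mul_inv_rev, ← Subgroup.inv_mem_iff]
  have h : (t⁻¹ * (k : ↥(unitaryGroupOfForm σ ((StdForm.antidiagonal 2).over K)))⁻¹ * t)⁻¹ =
      t⁻¹ * (k : ↥(unitaryGroupOfForm σ ((StdForm.antidiagonal 2).over K))) * t := by
    group
  rw [h]

/-- **THE STABILISER OF `t_a K₀`, EXPLICITLY** (`a = (n, −n)`, `n ≥ 0`, `t_a = diag(ϖⁿ, ϖ⁻ⁿ)`): for `k ∈ K₀`, `t_a⁻¹ k t_a ∈ K₀` iff
`ϖ^{−2n} k₀₁` and `ϖ^{−2n} (k⁻¹)₀₁` are integral — conjugation by `t_a` scales the `(i,j)` entry by `ϖ^{a_j − a_i}` (★ `coe_zpowDiagGL_inv_mul_mul_apply`),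
the diagonal entries are untouched and the `(1,0)` entries gain `ϖ^{2n} ∈ 𝒪`. [cite: BruhatTits1972, (4.4.4)] [cite: Serre1980Trees, II.1.1] -/
private theorem conj_mem_unitaryInt_iff (hϖ : Valued.v ϖ = WithZero.exp (-1 : ℤ)) (hσϖ : σ ϖ = ϖ) {a : Fin 2 → ℤ}
    (ha : Antitone a ∧ ∀ i, a (Fin.rev i) = -a i) {k : ↥(unitaryGroupOfForm σ ((StdForm.antidiagonal 2).over K))}
    (hk : k ∈ unitaryInt σ ((StdForm.antidiagonal 2).over K)) :
    (⟨zpowDiagGL (uniformizer_ne_zero hϖ) a, zpowDiagGL_mem_unitaryGroupOfForm hσϖ _ ha.2⟩ :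
          ↥(unitaryGroupOfForm σ ((StdForm.antidiagonal 2).over K)))⁻¹ * k *
        ⟨zpowDiagGL (uniformizer_ne_zero hϖ) a, zpowDiagGL_mem_unitaryGroupOfForm hσϖ _ ha.2⟩ ∈
        unitaryInt σ ((StdForm.antidiagonal 2).over K) ↔
      Valued.v (ϖ ^ (a 1 - a 0) * ((k : GL (Fin 2) K) : Matrix (Fin 2) (Fin 2) K) 0 1) ≤ 1 ∧
      Valued.v (ϖ ^ (a 1 - a 0) * (((k : GL (Fin 2) K)⁻¹ : GL (Fin 2) K) : Matrix (Fin 2) (Fin 2) K) 0 1) ≤ 1 := by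
  obtain ⟨h10, h0⟩ := cartan_two_shape ha
  set hϖ0 := uniformizer_ne_zero hϖ with hϖ0_def
  set t : ↥(unitaryGroupOfForm σ ((StdForm.antidiagonal 2).over K)) :=
    ⟨zpowDiagGL hϖ0 a, zpowDiagGL_mem_unitaryGroupOfForm hσϖ _ ha.2⟩ with ht
  have hval : ((t⁻¹ * k * t : ↥(unitaryGroupOfForm σ ((StdForm.antidiagonal 2).over K))) : GL (Fin 2) K) =
      (zpowDiagGL hϖ0 a)⁻¹ * (k : GL (Fin 2) K) * zpowDiagGL hϖ0 a := rfl
  have hinv : (((t⁻¹ * k * t : ↥(unitaryGroupOfForm σ ((StdForm.antidiagonal 2).over K))) : GL (Fin 2) K))⁻¹ =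
      (zpowDiagGL hϖ0 a)⁻¹ * (k : GL (Fin 2) K)⁻¹ * zpowDiagGL hϖ0 a := by
    rw [hval]; group
  obtain ⟨hkO, hkO'⟩ := mem_unitaryInt_iff.1 hk
  rw [mem_unitaryInt_iff, hinv, hval]
  simp only [coe_zpowDiagGL_inv_mul_mul_apply]
  constructor
  · rintro ⟨h, h'⟩
    exact ⟨h 0 1, h' 0 1⟩
  · rintro ⟨h, h'⟩
    have hdiag : ∀ (x : Matrix (Fin 2) (Fin 2) K) (i : Fin 2), Valued.v (x i i) ≤ 1 → Valued.v (ϖ ^ (a i - a i) * x i i) ≤ 1 := by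
      intro x i hx
      rwa [sub_self, zpow_zero, one_mul]
    have hlow : ∀ x : Matrix (Fin 2) (Fin 2) K, Valued.v (x 1 0) ≤ 1 → Valued.v (ϖ ^ (a 0 - a 1) * x 1 0) ≤ 1 := by
      intro x hx
      rw [map_mul]
      exact mul_le_one' (v_zpow_le_one hϖ (by omega)) hx
    refine ⟨Fin.forall_fin_two.2 ⟨Fin.forall_fin_two.2 ⟨hdiag _ 0 (hkO 0 0), h⟩, Fin.forall_fin_two.2 ⟨hlow _ (hkO 1 0), hdiag _ 1 (hkO 1 1)⟩⟩,
      Fin.forall_fin_two.2 ⟨Fin.forall_fin_two.2 ⟨hdiag _ 0 (hkO' 0 0), h'⟩, Fin.forall_fin_two.2 ⟨hlow _ (hkO' 1 0), hdiag _ 1 (hkO' 1 1)⟩⟩⟩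

/-- **NESTED STABILISERS**: `S_{a′} ≤ S_a` when `a 0 ≤ a′ 0` (`ϖ^{−2n′}x ∈ 𝒪 ⇒ ϖ^{−2n}x ∈ 𝒪`). [cite: Serre1980Trees, II.1.1] -/
private theorem stabilizer_anti (hϖ : Valued.v ϖ = WithZero.exp (-1 : ℤ)) (hσϖ : σ ϖ = ϖ) {a a' : Fin 2 → ℤ}
    (ha : Antitone a ∧ ∀ i, a (Fin.rev i) = -a i) (ha' : Antitone a' ∧ ∀ i, a' (Fin.rev i) = -a' i) (h : a 0 ≤ a' 0) :
    MulAction.stabilizer (↥(unitaryInt σ ((StdForm.antidiagonal 2).over K)))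
        ((⟨zpowDiagGL (uniformizer_ne_zero hϖ) a', zpowDiagGL_mem_unitaryGroupOfForm hσϖ _ ha'.2⟩ :
            ↥(unitaryGroupOfForm σ ((StdForm.antidiagonal 2).over K))) :
          ↥(unitaryGroupOfForm σ ((StdForm.antidiagonal 2).over K)) ⧸ unitaryInt σ ((StdForm.antidiagonal 2).over K)) ≤
      MulAction.stabilizer (↥(unitaryInt σ ((StdForm.antidiagonal 2).over K)))
        ((⟨zpowDiagGL (uniformizer_ne_zero hϖ) a, zpowDiagGL_mem_unitaryGroupOfForm hσϖ _ ha.2⟩ :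
            ↥(unitaryGroupOfForm σ ((StdForm.antidiagonal 2).over K))) :
          ↥(unitaryGroupOfForm σ ((StdForm.antidiagonal 2).over K)) ⧸ unitaryInt σ ((StdForm.antidiagonal 2).over K)) := by
  intro k hk
  obtain ⟨h10, h0⟩ := cartan_two_shape ha
  obtain ⟨h10', h0'⟩ := cartan_two_shape ha'
  rw [mem_stabilizer_coe_iff, conj_mem_unitaryInt_iff hϖ hσϖ ha' k.2] at hk
  rw [mem_stabilizer_coe_iff, conj_mem_unitaryInt_iff hϖ hσϖ ha k.2]
  have hϖ0 := uniformizer_ne_zero hϖ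
  -- `ϖ^{a₁ − a₀} x = ϖ^{(a₁−a₀) − (a′₁−a′₀)} · (ϖ^{a′₁ − a′₀} x)` with a non-negative first exponent
  have key : ∀ x : K, Valued.v (ϖ ^ (a' 1 - a' 0) * x) ≤ 1 → Valued.v (ϖ ^ (a 1 - a 0) * x) ≤ 1 := by
    intro x hx
    have hsplit : ϖ ^ (a 1 - a 0) * x = ϖ ^ ((a 1 - a 0) - (a' 1 - a' 0)) * (ϖ ^ (a' 1 - a' 0) * x) := by
      rw [← mul_assoc, ← zpow_add₀ hϖ0, sub_add_cancel]
    rw [hsplit, map_mul]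
    exact mul_le_one' (v_zpow_le_one hϖ (by omega)) hx
  exact ⟨key _ hk.1, key _ hk.2⟩

/-! ## §3 `σ ≠ id` from the residual Frobenius binders, and the strict step -/

/-- **A trace-zero unit**: the residual binders (`|𝓀| = q²`, `σ̄ = Frob_q`) force `σ̄ ≠ id` (★ `exists_frob_ne`), so some integral `a` has `σa − a` a UNIT;
`δ := σa − a` satisfies `σδ = −δ` (`σ` an involution) and `v δ = 1`. [cite: Serre1980Trees, II.1.1] [cite: Rogawski1990, §1.10 p. 9] -/
private theorem exists_neg_unit (hσσ : ∀ x, σ (σ x) = x) (hσO : ∀ x : 𝒪[K], σ x ∈ 𝒪[K]) (σk : 𝓀[K] →+* 𝓀[K])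
    (hσk : ∀ x : 𝒪[K], IsLocalRing.residue 𝒪[K] ⟨σ x, hσO x⟩ = σk (IsLocalRing.residue 𝒪[K] x))
    [Fintype 𝓀[K]] {q : ℕ} (hk : Fintype.card 𝓀[K] = q ^ 2) (hfrob : ∀ y, σk y = y ^ q) :
    ∃ δ : K, σ δ = -δ ∧ Valued.v δ = 1 := by
  obtain ⟨y, hy⟩ := Literature.LinearAlgebra.Matrix.exists_frob_ne hk σk hfrob
  obtain ⟨a, rfl⟩ := IsLocalRing.residue_surjective y
  refine ⟨σ a - a, by rw [map_sub, hσσ, neg_sub], ?_⟩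
  have hunit : IsUnit ((⟨σ a, hσO a⟩ : 𝒪[K]) - a) := by
    by_contra hna
    apply hy
    have hmem : (⟨σ a, hσO a⟩ : 𝒪[K]) - a ∈ IsLocalRing.maximalIdeal 𝒪[K] :=
      (IsLocalRing.mem_maximalIdeal _).2 (mem_nonunits_iff.2 hna)
    rw [← hσk, ← sub_eq_zero, ← map_sub, IsLocalRing.residue_eq_zero_iff]
    exact hmem
  exact isUnit_integer_iff.1 hunit

/-- **THE STRICT STEP**: for `a 0 < a′ 0` the unipotent `n(ϖ^{2n}δ) = (1 ϖ^{2n}δ; 0 1)` (`n = a 0`, `δ` a trace-zero unit) lies in `K₀`, fixes `t_a K₀`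
and moves `t_{a′} K₀` — so `S_{a′} ≠ S_a`. [cite: Rogawski1990, §1.10 p. 9] [cite: Serre1980Trees, II.1.1] -/
private theorem exists_mem_stabilizer_not_mem (hd : UnramifiedLocalConjDatum σ ϖ) {δ : K} (hσδ : σ δ = -δ) (hvδ : Valued.v δ = 1)
    {a a' : Fin 2 → ℤ} (ha : Antitone a ∧ ∀ i, a (Fin.rev i) = -a i) (ha' : Antitone a' ∧ ∀ i, a' (Fin.rev i) = -a' i)
    (h : a 0 < a' 0) :
    ∃ k : ↥(unitaryInt σ ((StdForm.antidiagonal 2).over K)),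
      k ∈ MulAction.stabilizer (↥(unitaryInt σ ((StdForm.antidiagonal 2).over K)))
          ((⟨zpowDiagGL (uniformizer_ne_zero hd.vϖ) a, zpowDiagGL_mem_unitaryGroupOfForm hd.σϖ _ ha.2⟩ :
              ↥(unitaryGroupOfForm σ ((StdForm.antidiagonal 2).over K))) :
            ↥(unitaryGroupOfForm σ ((StdForm.antidiagonal 2).over K)) ⧸ unitaryInt σ ((StdForm.antidiagonal 2).over K)) ∧
      k ∉ MulAction.stabilizer (↥(unitaryInt σ ((StdForm.antidiagonal 2).over K)))
          ((⟨zpowDiagGL (uniformizer_ne_zero hd.vϖ) a', zpowDiagGL_mem_unitaryGroupOfForm hd.σϖ _ ha'.2⟩ :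
              ↥(unitaryGroupOfForm σ ((StdForm.antidiagonal 2).over K))) :
            ↥(unitaryGroupOfForm σ ((StdForm.antidiagonal 2).over K)) ⧸ unitaryInt σ ((StdForm.antidiagonal 2).over K)) := by
  obtain ⟨h10, h0⟩ := cartan_two_shape ha
  obtain ⟨h10', h0'⟩ := cartan_two_shape ha'
  have hϖ := hd.vϖ
  have hϖ0 := uniformizer_ne_zero hϖ
  -- the unipotent `u = n(x)`, `x = ϖ^{a₀ − a₁} δ = ϖ^{2n} δ`
  set x : K := ϖ ^ (a 0 - a 1) * δ with hx
  obtain ⟨u, hu, hu'⟩ := exists_units_coe_eq_lineUnipotent x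
  have huU : u ∈ unitaryGroupOfForm σ ((StdForm.antidiagonal 2).over K) := by
    rw [mem_unitaryGroupOfForm_iff_of_coe_eq_lineUnipotent σ hu, hx, map_mul, map_zpow₀, hd.σϖ, hσδ]
    ring
  have hvx : Valued.v x ≤ 1 := by
    rw [hx, map_mul, hvδ, mul_one]
    exact v_zpow_le_one hϖ (by omega)
  have huK : (⟨u, huU⟩ : ↥(unitaryGroupOfForm σ ((StdForm.antidiagonal 2).over K))) ∈ unitaryInt σ ((StdForm.antidiagonal 2).over K) := by
    refine mem_unitaryInt_iff.2 ⟨?_, ?_⟩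
    · change ∀ i j, Valued.v ((u : Matrix (Fin 2) (Fin 2) K) i j) ≤ 1
      rw [hu]
      exact Fin.forall_fin_two.2 ⟨Fin.forall_fin_two.2 ⟨by simp, by simpa using hvx⟩, Fin.forall_fin_two.2 ⟨by simp, by simp⟩⟩
    · change ∀ i j, Valued.v (((u⁻¹ : GL (Fin 2) K) : Matrix (Fin 2) (Fin 2) K) i j) ≤ 1
      rw [hu']
      exact Fin.forall_fin_two.2 ⟨Fin.forall_fin_two.2 ⟨by simp, by simpa using hvx⟩, Fin.forall_fin_two.2 ⟨by simp, by simp⟩⟩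
  refine ⟨⟨⟨u, huU⟩, huK⟩, ?_, ?_⟩
  · -- `u` fixes `t_a K₀`: `ϖ^{a₁−a₀} x = δ` is a unit
    rw [mem_stabilizer_coe_iff, conj_mem_unitaryInt_iff hϖ hd.σϖ ha huK]
    change Valued.v (ϖ ^ (a 1 - a 0) * (u : Matrix (Fin 2) (Fin 2) K) 0 1) ≤ 1 ∧
      Valued.v (ϖ ^ (a 1 - a 0) * ((u⁻¹ : GL (Fin 2) K) : Matrix (Fin 2) (Fin 2) K) 0 1) ≤ 1
    rw [hu, hu']
    have hkey : ϖ ^ (a 1 - a 0) * x = δ := by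
      rw [hx, ← mul_assoc, ← zpow_add₀ hϖ0, show a 1 - a 0 + (a 0 - a 1) = 0 by ring, zpow_zero, one_mul]
    have e01 : (!![(1 : K), x; 0, 1]) 0 1 = x := rfl
    have e01' : (!![(1 : K), -x; 0, 1]) 0 1 = -x := rfl
    rw [e01, e01', mul_neg, Valuation.map_neg, hkey, hvδ]
    exact ⟨le_rfl, le_rfl⟩
  · -- `u` moves `t_{a′} K₀`: `v(ϖ^{a′₁−a′₀} x) = exp(2(a′₀ − a₀)) > 1`
    rw [mem_stabilizer_coe_iff, conj_mem_unitaryInt_iff hϖ hd.σϖ ha' huK, not_and_or]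
    left
    change ¬ Valued.v (ϖ ^ (a' 1 - a' 0) * (u : Matrix (Fin 2) (Fin 2) K) 0 1) ≤ 1
    rw [hu]
    have e01 : (!![(1 : K), x; 0, 1]) 0 1 = x := rfl
    rw [e01, hx, ← mul_assoc, ← zpow_add₀ hϖ0, map_mul, hvδ, mul_one, v_uniformizer_zpow hϖ, not_le, ← WithZero.exp_zero,
      WithZero.exp_lt_exp]
    omega

/-! ## §4 The shell index is strictly increasing, hence injective -/

/-- **`n ↦ #(K₀ t_n K₀ ∕ K₀)` IS STRICTLY INCREASING**: `a 0 < a′ 0 ⇒ #orbit(t_a K₀) < #orbit(t_{a′} K₀)` (orbit–stabiliser, `S_{a′} < S_a`, finite orbits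
★ `finite_orbit_quotient_unitaryInt`, Mathlib `Subgroup.index_strictAnti`). [cite: BruhatTits1972, (4.4.4)] [cite: Serre1980Trees, II.1.1] -/
private theorem ncard_orbit_lt (hd : UnramifiedLocalConjDatum σ ϖ) {δ : K} (hσδ : σ δ = -δ) (hvδ : Valued.v δ = 1) [Finite 𝓀[K]]
    {a a' : Fin 2 → ℤ} (ha : Antitone a ∧ ∀ i, a (Fin.rev i) = -a i) (ha' : Antitone a' ∧ ∀ i, a' (Fin.rev i) = -a' i)
    (h : a 0 < a' 0) :
    (MulAction.orbit (↥(unitaryInt σ ((StdForm.antidiagonal 2).over K)))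
        ((⟨zpowDiagGL (uniformizer_ne_zero hd.vϖ) a, zpowDiagGL_mem_unitaryGroupOfForm hd.σϖ _ ha.2⟩ :
            ↥(unitaryGroupOfForm σ ((StdForm.antidiagonal 2).over K))) :
          ↥(unitaryGroupOfForm σ ((StdForm.antidiagonal 2).over K)) ⧸ unitaryInt σ ((StdForm.antidiagonal 2).over K))).ncard <
      (MulAction.orbit (↥(unitaryInt σ ((StdForm.antidiagonal 2).over K)))
        ((⟨zpowDiagGL (uniformizer_ne_zero hd.vϖ) a', zpowDiagGL_mem_unitaryGroupOfForm hd.σϖ _ ha'.2⟩ :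
            ↥(unitaryGroupOfForm σ ((StdForm.antidiagonal 2).over K))) :
          ↥(unitaryGroupOfForm σ ((StdForm.antidiagonal 2).over K)) ⧸ unitaryInt σ ((StdForm.antidiagonal 2).over K))).ncard := by
  rw [← MulAction.index_stabilizer, ← MulAction.index_stabilizer]
  have hfin := finite_orbit_quotient_unitaryInt hd.vϖ σ ((StdForm.antidiagonal 2).over K)
    (⟨zpowDiagGL (uniformizer_ne_zero hd.vϖ) a', zpowDiagGL_mem_unitaryGroupOfForm hd.σϖ _ ha'.2⟩ :
      ↥(unitaryGroupOfForm σ ((StdForm.antidiagonal 2).over K)))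
  haveI : (MulAction.stabilizer (↥(unitaryInt σ ((StdForm.antidiagonal 2).over K)))
      ((⟨zpowDiagGL (uniformizer_ne_zero hd.vϖ) a', zpowDiagGL_mem_unitaryGroupOfForm hd.σϖ _ ha'.2⟩ :
          ↥(unitaryGroupOfForm σ ((StdForm.antidiagonal 2).over K))) :
        ↥(unitaryGroupOfForm σ ((StdForm.antidiagonal 2).over K)) ⧸ unitaryInt σ ((StdForm.antidiagonal 2).over K))).FiniteIndex :=
    ⟨by
      rw [MulAction.index_stabilizer]
      exact ((Set.ncard_pos hfin).2 ⟨_, MulAction.mem_orbit_self _⟩).ne'⟩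
  obtain ⟨k, hk, hk'⟩ := exists_mem_stabilizer_not_mem hd hσδ hvδ ha ha' h
  exact Subgroup.index_strictAnti (lt_of_le_of_ne (stabilizer_anti hd.vϖ hd.σϖ ha ha' h.le) fun heq => hk' (heq ▸ hk))

/-- **INJECTIVITY OF THE SHELL INDEX**: equal orbit sizes force equal Cartan exponents. [cite: BruhatTits1972, (4.4.3), (4.4.4)] -/
private theorem cartan_eq_of_ncard_orbit_eq (hd : UnramifiedLocalConjDatum σ ϖ) {δ : K} (hσδ : σ δ = -δ) (hvδ : Valued.v δ = 1) [Finite 𝓀[K]]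
    {a a' : Fin 2 → ℤ} (ha : Antitone a ∧ ∀ i, a (Fin.rev i) = -a i) (ha' : Antitone a' ∧ ∀ i, a' (Fin.rev i) = -a' i)
    (h : (MulAction.orbit (↥(unitaryInt σ ((StdForm.antidiagonal 2).over K)))
        ((⟨zpowDiagGL (uniformizer_ne_zero hd.vϖ) a, zpowDiagGL_mem_unitaryGroupOfForm hd.σϖ _ ha.2⟩ :
            ↥(unitaryGroupOfForm σ ((StdForm.antidiagonal 2).over K))) :
          ↥(unitaryGroupOfForm σ ((StdForm.antidiagonal 2).over K)) ⧸ unitaryInt σ ((StdForm.antidiagonal 2).over K))).ncard =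
      (MulAction.orbit (↥(unitaryInt σ ((StdForm.antidiagonal 2).over K)))
        ((⟨zpowDiagGL (uniformizer_ne_zero hd.vϖ) a', zpowDiagGL_mem_unitaryGroupOfForm hd.σϖ _ ha'.2⟩ :
            ↥(unitaryGroupOfForm σ ((StdForm.antidiagonal 2).over K))) :
          ↥(unitaryGroupOfForm σ ((StdForm.antidiagonal 2).over K)) ⧸ unitaryInt σ ((StdForm.antidiagonal 2).over K))).ncard) :
    a = a' := by
  refine cartan_two_ext ha ha' ?_
  rcases lt_trichotomy (a 0) (a' 0) with hlt | heq | hgt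
  · exact absurd h (ncard_orbit_lt hd hσδ hvδ ha ha' hlt).ne
  · exact heq
  · exact absurd h (ncard_orbit_lt hd hσδ hvδ ha' ha hgt).ne'

end

/-- **W8-e: THE INDEX OF A DOUBLE COSET SEPARATES THE `K₀`-DOUBLE COSETS OF `U(σ, antidiag(1,1))(K)` (the `hsep` payer at `N = 2`).**  For the
quasi-split unitary group `U = U(σ, J₀)(K)` in two variables over a discretely valued field `K` with an UNRAMIFIED local conjugation datum
(`σ` an isometric involution, `ϖ` a `σ`-fixed uniformiser) whose residue field has `q²` elements and on which `σ` reduces to the `q`-Frobenius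
(the inert-place binders), and its hyperspecial subgroup `K₀ = U ∩ GL₂(𝒪)`: if two cosets `g K₀`, `g′ K₀` have `K₀`-orbits of the SAME SIZE in `U ∕ K₀`
(= the same double-coset index `#(K₀ g K₀ ∕ K₀) = #(K₀ g′ K₀ ∕ K₀)`), then `g′ K₀ ∈ K₀ · g K₀`, i.e. `K₀ g′ K₀ = K₀ g K₀`.  Proof: Cartan
`g ∈ K₀ t_n K₀`, `g′ ∈ K₀ t_{n′} K₀` (★ `heckeCosetMk_zpowDiagGL_eq_of_unitary`), and the shell index `[K₀ : K₀ ∩ t_n K₀ t_n⁻¹]` is strictly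
increasing in `n` (nested stabilisers, strict by a trace-zero unipotent; the closed form `(q+1)q^{2n−1}` is not needed), so `n = n′`.
Statement = S6 WAVE 8 sheet target W8-e VERBATIM. [cite: BruhatTits1972, (4.4.3), (4.4.4)] [cite: Serre1980Trees, II.1.1] [cite: Rogawski1990, §1.10 p. 9] -/
theorem mem_orbit_of_ncard_orbit_eq_two {K : Type*} [Field K] [Valued K ℤᵐ⁰] {σ : K →+* K} {ϖ : K}
    (hd : UnramifiedLocalConjDatum σ ϖ) (hσO : ∀ x : 𝒪[K], σ x ∈ 𝒪[K]) (σk : 𝓀[K] →+* 𝓀[K])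
    (hσk : ∀ x : 𝒪[K], IsLocalRing.residue 𝒪[K] ⟨σ x, hσO x⟩ = σk (IsLocalRing.residue 𝒪[K] x))
    [Fintype 𝓀[K]] {q : ℕ} (hk : Fintype.card 𝓀[K] = q ^ 2) (hfrob : ∀ y, σk y = y ^ q)
    (g g' : unitaryGroupOfForm σ ((StdForm.antidiagonal 2).over K))
    (h : (MulAction.orbit (unitaryInt σ ((StdForm.antidiagonal 2).over K))
          (g : unitaryGroupOfForm σ ((StdForm.antidiagonal 2).over K) ⧸ unitaryInt σ ((StdForm.antidiagonal 2).over K))).ncard =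
        (MulAction.orbit (unitaryInt σ ((StdForm.antidiagonal 2).over K))
          (g' : unitaryGroupOfForm σ ((StdForm.antidiagonal 2).over K) ⧸ unitaryInt σ ((StdForm.antidiagonal 2).over K))).ncard) :
    (g' : unitaryGroupOfForm σ ((StdForm.antidiagonal 2).over K) ⧸ unitaryInt σ ((StdForm.antidiagonal 2).over K)) ∈
      MulAction.orbit (unitaryInt σ ((StdForm.antidiagonal 2).over K))
        (g : unitaryGroupOfForm σ ((StdForm.antidiagonal 2).over K) ⧸ unitaryInt σ ((StdForm.antidiagonal 2).over K)) := by
  obtain ⟨δ, hσδ, hvδ⟩ := exists_neg_unit hd.σσ hσO σk hσk hk hfrob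
  -- Cartan shells of `g` and `g′`
  obtain ⟨a, ha, hga⟩ := heckeCosetMk_zpowDiagGL_eq_of_unitary hd g
  obtain ⟨a', ha', hga'⟩ := heckeCosetMk_zpowDiagGL_eq_of_unitary hd g'
  obtain ⟨k₁, hk₁, k₂, hk₂, hg⟩ := (heckeAlgebra.heckeCosetMk_eq_iff (unitaryInt σ ((StdForm.antidiagonal 2).over K))
    (Submonoid.mem_top _) (Submonoid.mem_top _)).1 hga
  obtain ⟨k₁', hk₁', k₂', hk₂', hg'⟩ := (heckeAlgebra.heckeCosetMk_eq_iff (unitaryInt σ ((StdForm.antidiagonal 2).over K))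
    (Submonoid.mem_top _) (Submonoid.mem_top _)).1 hga'
  -- the orbits of `g K₀`, `g′ K₀` are those of the shell representatives
  have horb : MulAction.orbit (↥(unitaryInt σ ((StdForm.antidiagonal 2).over K)))
        (g : unitaryGroupOfForm σ ((StdForm.antidiagonal 2).over K) ⧸ unitaryInt σ ((StdForm.antidiagonal 2).over K)) =
      MulAction.orbit (↥(unitaryInt σ ((StdForm.antidiagonal 2).over K)))
        ((⟨zpowDiagGL (uniformizer_ne_zero hd.vϖ) a, zpowDiagGL_mem_unitaryGroupOfForm hd.σϖ _ ha.2⟩ :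
            ↥(unitaryGroupOfForm σ ((StdForm.antidiagonal 2).over K))) :
          ↥(unitaryGroupOfForm σ ((StdForm.antidiagonal 2).over K)) ⧸ unitaryInt σ ((StdForm.antidiagonal 2).over K)) :=
    MulAction.orbit_eq_iff.2 ((heckeAlgebra.coe_mem_orbit_coe_iff (unitaryInt σ ((StdForm.antidiagonal 2).over K)) _ _).2
      ⟨k₁, hk₁, k₂, hk₂, hg⟩)
  have horb' : MulAction.orbit (↥(unitaryInt σ ((StdForm.antidiagonal 2).over K)))
        (g' : unitaryGroupOfForm σ ((StdForm.antidiagonal 2).over K) ⧸ unitaryInt σ ((StdForm.antidiagonal 2).over K)) =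
      MulAction.orbit (↥(unitaryInt σ ((StdForm.antidiagonal 2).over K)))
        ((⟨zpowDiagGL (uniformizer_ne_zero hd.vϖ) a', zpowDiagGL_mem_unitaryGroupOfForm hd.σϖ _ ha'.2⟩ :
            ↥(unitaryGroupOfForm σ ((StdForm.antidiagonal 2).over K))) :
          ↥(unitaryGroupOfForm σ ((StdForm.antidiagonal 2).over K)) ⧸ unitaryInt σ ((StdForm.antidiagonal 2).over K)) :=
    MulAction.orbit_eq_iff.2 ((heckeAlgebra.coe_mem_orbit_coe_iff (unitaryInt σ ((StdForm.antidiagonal 2).over K)) _ _).2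
      ⟨k₁', hk₁', k₂', hk₂', hg'⟩)
  rw [horb, horb'] at h
  -- equal indices ⇒ equal shells
  haveI : Finite 𝓀[K] := inferInstance
  have haa : a = a' := cartan_eq_of_ncard_orbit_eq hd hσδ hvδ ha ha' h
  subst haa
  -- `g′ = k₁′ t k₂′ = (k₁′ k₁⁻¹) g (k₂⁻¹ k₂′)`
  refine (heckeAlgebra.coe_mem_orbit_coe_iff (unitaryInt σ ((StdForm.antidiagonal 2).over K)) g g').2
    ⟨k₁' * k₁⁻¹, Subgroup.mul_mem _ hk₁' (Subgroup.inv_mem _ hk₁), k₂⁻¹ * k₂', Subgroup.mul_mem _ (Subgroup.inv_mem _ hk₂) hk₂', ?_⟩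
  rw [hg', hg]
  group

end Summit.HodgeConjecture.HodgeConjecture.R90.S6

end
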